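import Mathlib
import Summits.Ventures.PercRepro.TriangleCapFourRowThree
import Summits.Ventures.PercRepro.TriangleCapNonBipTable

/-!
# PercRepro — THE NON-BIPARTITE SECOND-BEST VALUE ON THE CELL `(k, 4, 3)`: exactly `B2 = 2k − 18` below the closed
form, by `K_{5,k−5}` minus a `(k − 6)`-star — the non-bipartite stability table extends to its first cell with
`r = 3` (p3, gen 46; part 199e)

Part 199d bounds every non-`4`-bipartite `K₄⁻`-free graph on `(k, 4, 3)` by `m k − 3 (k − 4) − (2k − 18)`. The witness
`bipMinusStar k 5 (k − 6)` (`K_{5,k−5}` with vertex `0` of the `5`-side keeping a single neighbour) attains it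
(`sums_bipMinusStar`) and is `4`-bipartite for no `A`: its vertices `1, 2, 3, 4` have degree `k − 5 ≥ 6` and its last
vertex degree `5`, and a spanning subgraph of `K(A, Aᶜ)` with `|A| = 4` has every vertex of degree `≥ 5` inside `A`
(`deg_le_card_of_bipSub`) — five of them do not fit (`not_bipSub_four_of_five`). `four_three_nonbip_second_best`:
the maximum of `Σ_v d(v)²` over the non-`4`-bipartite `K₄⁻`-free graphs on `Fin k` with `4 (k − 4) − 3` edges is
EXACTLY `m k − 3 (k − 4) − (2k − 18)` (`k ≥ 11`); `nonbip_second_best_table_four_three`: the same in the vocabulary of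
part 198's table (`nonbipGap k 4 3 = 2 (k − 9)`). Axioms: standard.
-/

namespace PercRepro

namespace TriangleCap

namespace C047

open Finset

variable {V : Type*} [Fintype V] [DecidableEq V]

/-- Five distinct vertices of degree `≥ 5` do not fit into the `4`-side of a spanning subgraph of `K(A, Aᶜ)`. -/
theorem not_bipSub_four_of_five (D : SimpleGraph V) [DecidableRel D.Adj] (v₁ v₂ v₃ v₄ v₅ : V)
    (h12 : v₁ ≠ v₂) (h13 : v₁ ≠ v₃) (h14 : v₁ ≠ v₄) (h15 : v₁ ≠ v₅) (h23 : v₂ ≠ v₃) (h24 : v₂ ≠ v₄)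
    (h25 : v₂ ≠ v₅) (h34 : v₃ ≠ v₄) (h35 : v₃ ≠ v₅) (h45 : v₄ ≠ v₅)
    (hd1 : 5 ≤ deg D v₁) (hd2 : 5 ≤ deg D v₂) (hd3 : 5 ≤ deg D v₃) (hd4 : 5 ≤ deg D v₄) (hd5 : 5 ≤ deg D v₅)
    (A : Finset V) (hA : A.card = 4) : ¬ BipSub D A := by
  intro hB
  have hin : ∀ v, 5 ≤ deg D v → v ∈ A := by
    intro v hv
    by_contra h
    have := deg_le_card_of_bipSub D A hB v h
    omega
  have hsub : ({v₁, v₂, v₃, v₄, v₅} : Finset V) ⊆ A := by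
    intro v hv
    simp only [mem_insert, mem_singleton] at hv
    rcases hv with rfl | rfl | rfl | rfl | rfl
    · exact hin _ hd1
    · exact hin _ hd2
    · exact hin _ hd3
    · exact hin _ hd4
    · exact hin _ hd5
  have hcard : ({v₁, v₂, v₃, v₄, v₅} : Finset V).card = 5 := by
    rw [card_insert_of_notMem, card_insert_of_notMem, card_insert_of_notMem, card_insert_of_notMem,
      card_singleton]
    · simp [h45]
    · simp [h34, h35]
    · simp [h23, h24, h25]
    · simp [h12, h13, h14, h15]
  have := card_le_card hsub
  omega

/-- The degrees of the witness `bipMinusStar k 5 (k − 6)`: `k − 5` at the vertices `1, 2, 3, 4` of the `5`-side. -/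
theorem four_three_witness_deg_small (k : ℕ) (hk : 11 ≤ k) (i : ℕ) (hi1 : 1 ≤ i) (hi : i < 5) :
    deg (bipMinusStar k 5 (k - 6)) ⟨i, by omega⟩ = k - 5 := by
  rw [deg_bipMinusStar k 5 (k - 6) (by norm_num) (by omega)]
  have h0 : (⟨i, by omega⟩ : Fin k).val ≠ 0 := by simp only; omega
  have hst : (⟨i, by omega⟩ : Fin k) ∉ rightStar k 5 (k - 6) := by
    rw [rightStar, mem_filter]
    simp only [mem_univ, true_and]
    omega
  rw [if_neg h0, if_neg hst]
  exact deg_bip_of_lt k 5 (by omega) _ (by simp only; omega)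

/-- The degree of the witness `bipMinusStar k 5 (k − 6)` at its last vertex: `5`. -/
theorem four_three_witness_deg_last (k : ℕ) (hk : 11 ≤ k) :
    deg (bipMinusStar k 5 (k - 6)) ⟨k - 1, by omega⟩ = 5 := by
  rw [deg_bipMinusStar k 5 (k - 6) (by norm_num) (by omega)]
  have h0 : (⟨k - 1, by omega⟩ : Fin k).val ≠ 0 := by simp only; omega
  have hst : (⟨k - 1, by omega⟩ : Fin k) ∉ rightStar k 5 (k - 6) := by
    rw [rightStar, mem_filter]
    simp only [mem_univ, true_and]
    omega
  rw [if_neg h0, if_neg hst]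
  exact deg_bip_of_not_lt k 5 (by omega) _ (by simp only; omega)

/-- **THE WITNESS ON `(k, 4, 3)`:** `bipMinusStar k 5 (k − 6)` is `K₄⁻`-free with `4 (k − 4) − 3` edges, is
`4`-bipartite for no `A`, and has `Σ_v d(v)² + 3 (k − 4) + (2k − 18) = m k` (`k ≥ 11`). -/
theorem four_three_witness (k : ℕ) (hk : 11 ≤ k) :
    K4mFree (bipMinusStar k 5 (k - 6)) ∧ (bipMinusStar k 5 (k - 6)).edgeFinset.card + 3 = 4 * (k - 4) ∧
      (¬ ∃ A : Finset (Fin k), A.card = 4 ∧ BipSub (bipMinusStar k 5 (k - 6)) A) ∧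
      ∑ v, deg (bipMinusStar k 5 (k - 6)) v * deg (bipMinusStar k 5 (k - 6)) v + 3 * (k - 4) + (2 * k - 18) =
        (bipMinusStar k 5 (k - 6)).edgeFinset.card * k := by
  have hE := card_edges_bipMinusStar k 5 (k - 6) (by norm_num) (by omega)
  have hS := (sums_bipMinusStar k 5 (k - 6) (by norm_num) (by omega)).2
  refine ⟨k4mFree_bipMinusStar k 5 (k - 6), by omega, ?_, ?_⟩
  · rintro ⟨A, hA, hB⟩
    have h5k : 5 ≤ k := by omega
    have hne : ∀ (i j : ℕ) (hi : i < 5) (hj : j < 5), i ≠ j →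
        (⟨i, lt_of_lt_of_le hi h5k⟩ : Fin k) ≠ ⟨j, lt_of_lt_of_le hj h5k⟩ := by
      intro i j _ _ hij h
      have := congrArg Fin.val h
      simp only at this
      exact hij this
    have hnel : ∀ (i : ℕ) (hi : i < 5), (⟨i, lt_of_lt_of_le hi h5k⟩ : Fin k) ≠ ⟨k - 1, by omega⟩ := by
      intro i _ h
      have := congrArg Fin.val h
      simp only at this
      omega
    have hd : ∀ (i : ℕ) (hi1 : 1 ≤ i) (hi : i < 5),
        5 ≤ deg (bipMinusStar k 5 (k - 6)) ⟨i, lt_of_lt_of_le hi h5k⟩ := by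
      intro i hi1 hi
      rw [four_three_witness_deg_small k hk i hi1 hi]
      omega
    exact not_bipSub_four_of_five (bipMinusStar k 5 (k - 6)) ⟨1, by omega⟩ ⟨2, by omega⟩ ⟨3, by omega⟩
      ⟨4, by omega⟩ ⟨k - 1, by omega⟩ (hne 1 2 (by norm_num) (by norm_num) (by norm_num))
      (hne 1 3 (by norm_num) (by norm_num) (by norm_num)) (hne 1 4 (by norm_num) (by norm_num) (by norm_num))
      (hnel 1 (by norm_num)) (hne 2 3 (by norm_num) (by norm_num) (by norm_num))
      (hne 2 4 (by norm_num) (by norm_num) (by norm_num)) (hnel 2 (by norm_num))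
      (hne 3 4 (by norm_num) (by norm_num) (by norm_num)) (hnel 3 (by norm_num)) (hnel 4 (by norm_num))
      (hd 1 (by norm_num) (by norm_num)) (hd 2 (by norm_num) (by norm_num)) (hd 3 (by norm_num) (by norm_num))
      (hd 4 (by norm_num) (by norm_num)) (by rw [four_three_witness_deg_last k hk]) A hA hB
  · obtain ⟨S, hSdef⟩ : ∃ S, ∑ v, deg (bipMinusStar k 5 (k - 6)) v * deg (bipMinusStar k 5 (k - 6)) v = S :=
      ⟨_, rfl⟩
    obtain ⟨E, hEdef⟩ : ∃ E, (bipMinusStar k 5 (k - 6)).edgeFinset.card = E := ⟨_, rfl⟩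
    rw [hSdef] at hS
    rw [hEdef] at hE
    rw [hSdef, hEdef]
    obtain ⟨s, rfl⟩ : ∃ s, k = s + 11 := ⟨k - 11, by omega⟩
    have e2 : 2 * (s + 11) - (s + 11 - 6) - 1 = s + 16 := by omega
    have e1 : s + 11 - 6 = s + 5 := by omega
    have e3 : s + 11 - 5 = s + 6 := by omega
    have e4 : s + 11 - 4 = s + 7 := by omega
    have e5 : 2 * (s + 11) - 18 = 2 * s + 4 := by omega
    rw [e2, e1, e3] at hS
    rw [e1, e3] at hE
    rw [e4, e5]
    have hE' : E = 4 * s + 25 := by omega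
    subst hE'
    nlinarith [hS]

/-- **THE NON-BIPARTITE SECOND-BEST VALUE ON `(k, 4, 3)`, `k ≥ 11`:** every non-`4`-bipartite `K₄⁻`-free graph on
`Fin k` with `4 (k − 4) − 3` edges has `Σ_v d(v)² + 3 (k − 4) + (2k − 18) ≤ m k`, and the value is attained by a
non-`4`-bipartite graph (`K_{5,k−5}` minus a `(k − 6)`-star). -/
theorem four_three_nonbip_second_best (k : ℕ) (hk : 11 ≤ k) :
    (∀ (D : SimpleGraph (Fin k)) [DecidableRel D.Adj], K4mFree D → D.edgeFinset.card + 3 = 4 * (k - 4) →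
        (¬ ∃ A : Finset (Fin k), A.card = 4 ∧ BipSub D A) →
        ∑ v, deg D v * deg D v + 3 * (k - 4) + (2 * k - 18) ≤ D.edgeFinset.card * k) ∧
      ∃ (D : SimpleGraph (Fin k)) (_ : DecidableRel D.Adj), K4mFree D ∧ D.edgeFinset.card + 3 = 4 * (k - 4) ∧
        (¬ ∃ A : Finset (Fin k), A.card = 4 ∧ BipSub D A) ∧
        ∑ v, deg D v * deg D v + 3 * (k - 4) + (2 * k - 18) = D.edgeFinset.card * k := by
  have hcard : Fintype.card (Fin k) = k := Fintype.card_fin k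
  refine ⟨?_, ?_⟩
  · intro D _ hK hm hnb
    rcases four_three_second_order D hK (by omega) (by rw [hcard]; exact hm) with h | h
    · exact absurd h hnb
    · rw [hcard] at h
      exact h
  · obtain ⟨hK, hE, hnb, hS⟩ := four_three_witness k hk
    exact ⟨bipMinusStar k 5 (k - 6), inferInstance, hK, hE, hnb, hS⟩

/-- **THE NON-BIPARTITE STABILITY TABLE EXTENDS TO THE CELL `(k, 4, 3)`** (`nonbipGap k 4 3 = 2 (k − 9)`): for
`11 ≤ k`, every non-`4`-bipartite `K₄⁻`-free graph on `Fin k` with `4 (k − 4) − 3` edges has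
`Σ_v d(v)² + 3 (k − 1 − 3) + nonbipGap k 4 3 ≤ m k`, and the value is attained by a non-`4`-bipartite graph. -/
theorem nonbip_second_best_table_four_three (k : ℕ) (hk : 11 ≤ k) :
    (∀ (D : SimpleGraph (Fin k)) [DecidableRel D.Adj], K4mFree D → D.edgeFinset.card + 3 = 4 * (k - 4) →
        (¬ ∃ A : Finset (Fin k), A.card = 4 ∧ BipSub D A) →
        ∑ v, deg D v * deg D v + 3 * (k - 1 - 3) + nonbipGap k 4 3 ≤ D.edgeFinset.card * k) ∧
      ∃ (D : SimpleGraph (Fin k)) (_ : DecidableRel D.Adj), K4mFree D ∧ D.edgeFinset.card + 3 = 4 * (k - 4) ∧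
        (¬ ∃ A : Finset (Fin k), A.card = 4 ∧ BipSub D A) ∧
        ∑ v, deg D v * deg D v + 3 * (k - 1 - 3) + nonbipGap k 4 3 = D.edgeFinset.card * k := by
  have hgap : nonbipGap k 4 3 = 2 * (k - 9) := by
    unfold nonbipGap
    simp
  have e : 3 * (k - 1 - 3) = 3 * (k - 4) := by omega
  have e2 : 2 * (k - 9) = 2 * k - 18 := by omega
  rw [hgap, e, e2]
  exact four_three_nonbip_second_best k hk

end C047

end TriangleCap

end PercRepro
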